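import Mathlib.Analysis.SpecialFunctions.Pow.Real

/-!
# K1loc, line `Spectral` / thin start — helper: arithmetic of the side conditions of the ledger steps (choice of `d₀`, `M`, `ε₀`)

Helper file of the prover lane on the crux `K1LocalisedCascade` (stmt-AnomalousDissipation-19491), route
`SawtoothPulseCascade` (S-D fibre ledger; memo v13 §15).  Every ledger step (`…StripStepV(Log/Log2)`, `…RatioClassStepV/H(…)`, …)
carries the side conditions `0 < d₀`, `Mδ_j < πN_j d₀`, `8τ ≤ A d₀` (envelope scale), `1 ≤ M`, `Mδ_j < π/2` (zone depth) and
`A·(2πΛ'G·e^{−M²/2}/(2N_j)) ≤ ε₀` (rounding).  The assembly discharges them with the canonical choices proved here: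
* `envelopeScale_facts` — `d₀ := 8τ/A + Mδ/(πN)` satisfies all three envelope conditions (`A, τ, N, Mδ > 0`);
* `exp_neg_sq_half_le` — `e^{−M²/2} ≤ η` as soon as `M² ≥ 2·log(1/η)` (`η > 0`);
* `zoneDepth_facts` — with `M := max 1 √(2·log(1/η))`: `1 ≤ M`, `e^{−M²/2} ≤ η`.
Pure real arithmetic; no definitions; no statement about the crux. [cite: Grafakos2014, Prop. 3.2.7 (3)] [problem: turb]
-/

-- `Summit.<Summit>.<Problem>`: single-conjunct summit, the duplicate namespace segment is deliberate.
set_option linter.dupNamespace false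

noncomputable section

namespace Summit.AnomalousDissipation.AnomalousDissipation.Theorems.SawtoothPulseCascade.K1Window

/-- **Canonical envelope scale**: for `A, τ, N, Mδ > 0` the choice `d₀ = 8τ/A + Mδ/(πN)` gives `0 < d₀`, `Mδ < πN·d₀` and
`8τ ≤ A·d₀`. [folklore] -/
theorem envelopeScale_facts {A τ N Mδ : ℝ} (hA : 0 < A) (hτ : 0 < τ) (hN : 0 < N) (hMδ : 0 < Mδ) :
    0 < 8 * τ / A + Mδ / (Real.pi * N) ∧ Mδ < Real.pi * N * (8 * τ / A + Mδ / (Real.pi * N)) ∧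
      8 * τ ≤ A * (8 * τ / A + Mδ / (Real.pi * N)) := by
  have hπ : 0 < Real.pi := Real.pi_pos
  have h1 : 0 < 8 * τ / A := by positivity
  have h2 : 0 < Mδ / (Real.pi * N) := by positivity
  refine ⟨by positivity, ?_, ?_⟩
  · have e : Real.pi * N * (8 * τ / A + Mδ / (Real.pi * N)) = Real.pi * N * (8 * τ / A) + Mδ := by
      field_simp
    rw [e]
    linarith [mul_pos (mul_pos hπ hN) h1]
  · have e : A * (8 * τ / A + Mδ / (Real.pi * N)) = 8 * τ + A * (Mδ / (Real.pi * N)) := by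
      field_simp
    rw [e]
    linarith [mul_pos hA h2]

/-- **Zone depth vs rounding error**: `e^{−M²/2} ≤ η` when `2·log(1/η) ≤ M²` (`η > 0`). [folklore] -/
theorem exp_neg_sq_half_le {M η : ℝ} (hη : 0 < η) (hM : 2 * Real.log (1 / η) ≤ M ^ 2) :
    Real.exp (-(M ^ 2 / 2)) ≤ η := by
  have h1 : -(M ^ 2 / 2) ≤ Real.log η := by
    have : Real.log (1 / η) = -Real.log η := by rw [one_div, Real.log_inv]
    rw [this] at hM
    linarith
  calc Real.exp (-(M ^ 2 / 2)) ≤ Real.exp (Real.log η) := Real.exp_le_exp.mpr h1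
    _ = η := Real.exp_log hη

/-- **Canonical zone depth**: `M := max 1 √(2·log(1/η))` satisfies `1 ≤ M` and `e^{−M²/2} ≤ η` (`η > 0`). [folklore] -/
theorem zoneDepth_facts {η : ℝ} (hη : 0 < η) :
    1 ≤ max 1 (Real.sqrt (2 * Real.log (1 / η))) ∧
      Real.exp (-((max 1 (Real.sqrt (2 * Real.log (1 / η)))) ^ 2 / 2)) ≤ η := by
  refine ⟨le_max_left _ _, exp_neg_sq_half_le hη ?_⟩
  set M := max 1 (Real.sqrt (2 * Real.log (1 / η))) with hM
  have hM1 : Real.sqrt (2 * Real.log (1 / η)) ≤ M := le_max_right _ _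
  have hM0 : 0 ≤ M := le_trans zero_le_one (le_max_left _ _)
  by_cases h : 0 ≤ 2 * Real.log (1 / η)
  · have hs : Real.sqrt (2 * Real.log (1 / η)) ^ 2 = 2 * Real.log (1 / η) := Real.sq_sqrt h
    calc 2 * Real.log (1 / η) = Real.sqrt (2 * Real.log (1 / η)) ^ 2 := hs.symm
      _ ≤ M ^ 2 := pow_le_pow_left₀ (Real.sqrt_nonneg _) hM1 2
  · push Not at h
    linarith [sq_nonneg M]

end Summit.AnomalousDissipation.AnomalousDissipation.Theorems.SawtoothPulseCascade.K1Window
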